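import Literature.Barriers.CriticalPhenomena.PlaquetteWalkHoleRootKillSignSchema
import HarnessLib

/-!
# Barrier catalogue (SAWScalingLimit): the EAST sign schemas with the CLOSED-CORRIDOR column clause — the master form
of the column condition — and the corner-kill table's corridor row `57b (4,4)` as a closed theorem

Leaf of `PlaquetteWalkHoleRootKillSignSchema`. The eastern kill schemas (`K_S1 = (w.1 + 1, w.2 − 2)` kills the under
route's `w₁`-free class, `K_N2 = (w.1 + 1, w.2 + 2)` the over route's `w₂`-free class) carry a column clause on the
western doors of column `w.1 + 1` below (above) the kill row: two-way («no door», `PlaquetteWalkHoleRootEastQuadrant`)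
or three-way («… or a dead end behind it»). Both are instances of ONE clause, typed here: there is a set `R` of
cells east of the root plaquette's column — a CLOSED CORRIDOR — whose only doors to the rest of the domain are western
doors of column `w.1 + 1` at rows below the kill row, and every usable such door leads into `R` (`IsCorridorS`;
`R = ∅` is the two-way clause, `R = {dead end}` the three-way one, `R = {(w.1+1, y), (w.1+1, y−1)}` the two-cell corridor
of the corner-kill table's frame `57b`). MECHANISM (the even–odd rule once more): a walk to the far cell starts and
ends outside `R`, so its crossings of `R`'s doors are EVEN in number on the excursion range
(`even_card_changes_iff`); the parity lemma of the east quadrant leaf makes the excursion's crossings of the west edges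
of the south-eastern quadrant ODD (`ΩG.cross_root_S_or_odd_card_westEdgeSE`, the leaf's count exported); the west edges
at unusable rows and at the kill row are not crossed; so the `E` side of the cell below the root plaquette is crossed
an odd number of times — at least once (`ΩG.cross_root_S_or_exists_nth_eq_rootS_E_corridor`), and the chain of the
quadrant leaf runs unchanged: `kindsIn_rootS_or_root_eq_of_AJ_ne_zero_under_corridor`,
`ΩG.under_w1_killed_of_killSE_corridor`, the row-mirror twin `ΩG.over_w2_killed_of_killNE_corridor` (`IsCorridorN`),
the sign schemas at the reference position (§6) and — translating `R` with the domain, `isCorridorS_refShift` —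
at every position (§7): ★ `im_vertexFunctional_printed_two_pi_div_three_pos_of_killSE_corridor`,
`…_pi_div_three_neg_of_killNE_corridor`. §8: the corner-kill table's row `57b (4,4)` (`5×7 ∖ {(2,2), (4,4)}`, corridor
`{(4,5), (4,6)}`, no local column clause applies): `frame57b_KN2_sign` — with `PlaquetteWalkHoleRootLawLCertified`,
`PlaquetteWalkHoleRootEastDeadEnd` and «LAW L TABLE», 43 of the table's 44 kills are closed theorems; the last,
`57b (0,4)`, is the WEST corridor `{(0,5), (0,6)}` (the same surgery on the west pocket lemma of
`PlaquetteWalkHoleRootStructuralKillQuadrant`).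

Not in print; venture lane «pcv-sawmu», seat b-step0 gen 25.

References: A. Glazman, I. Manolescu, arXiv:1708.00395v3, §1, §4.2 and Lemma 2.1 [GlazmanManolescu2019]; A. Glazman,
Electron. Commun. Probab. 20 (2015) no. 86, Lemma 3.1 [Glazman2015WeightedSAW]; R. Courant, H. Robbins, *What is
Mathematics?* (1941/1958), Ch. V Appendix §2 [CourantRobbins1958].
-/

noncomputable section

open Set Function Complex

namespace Literature.Probability.RandomPlanarGeometry.SAW.YangBaxter

open Real
open Literature.Barriers.CriticalPhenomena.PlaquetteWalk (mirrorRowFace mirrorRowFace_mirrorRowFace)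

open private fc_ne from Literature.Probability.RandomPlanarGeometry.YangBaxterSAWGeneralDomain
open private side_jOut from Literature.Probability.RandomPlanarGeometry.YangBaxterSAWExcursionJordan

/-! ## §1 Closed corridors -/

section Corridors

variable (w : Face)

/-- **A closed corridor below the kill row** (southern form): a set `R` of cells east of the root plaquette's column
whose eastern, northern and southern neighbours inside the domain stay in `R`, and whose western neighbours inside the
domain but outside `R` occur only for cells of column `w.1 + 1` at rows `≤ w.2 − 3` — the western doors of that
column below the kill row are the ONLY doors of `R`. [cite: CourantRobbins1958, Ch. V Appendix §2 (the even–odd rule)] -/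
def IsCorridorS (D R : Set Face) : Prop :=
  ∀ c ∈ R, w.1 + 1 ≤ c.1 ∧ (((c.1 + 1, c.2) : Face) ∈ D → ((c.1 + 1, c.2) : Face) ∈ R) ∧
    (((c.1, c.2 + 1) : Face) ∈ D → ((c.1, c.2 + 1) : Face) ∈ R) ∧
    (((c.1, c.2 - 1) : Face) ∈ D → ((c.1, c.2 - 1) : Face) ∈ R) ∧
    (((c.1 - 1, c.2) : Face) ∈ D → ((c.1 - 1, c.2) : Face) ∉ R → c.1 = w.1 + 1 ∧ c.2 ≤ w.2 - 3)

/-- **A closed corridor above the kill row** (northern form, the row mirror). [cite: CourantRobbins1958, Ch. V Appendix §2 (the even–odd rule)] -/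
def IsCorridorN (D R : Set Face) : Prop :=
  ∀ c ∈ R, w.1 + 1 ≤ c.1 ∧ (((c.1 + 1, c.2) : Face) ∈ D → ((c.1 + 1, c.2) : Face) ∈ R) ∧
    (((c.1, c.2 + 1) : Face) ∈ D → ((c.1, c.2 + 1) : Face) ∈ R) ∧
    (((c.1, c.2 - 1) : Face) ∈ D → ((c.1, c.2 - 1) : Face) ∈ R) ∧
    (((c.1 - 1, c.2) : Face) ∈ D → ((c.1 - 1, c.2) : Face) ∉ R → c.1 = w.1 + 1 ∧ w.2 + 3 ≤ c.2)

variable {w}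

/-- **The doors of a closed corridor** are western doors of column `w.1 + 1` below the kill row.
[cite: CourantRobbins1958, Ch. V Appendix §2 (the even–odd rule)] -/
theorem exists_eq_vert_of_corridor_door {D R : Set Face} (hR : IsCorridorS w D R) {e : MidEdge}
    (hd : e.faces.1 ∈ D ∧ e.faces.2 ∈ D) (hx : ¬(e.faces.1 ∈ R ↔ e.faces.2 ∈ R)) :
    ∃ y : ℤ, y ≤ w.2 - 3 ∧ e = MidEdge.vert (w.1 + 1) y := by
  cases e with
  | vert x y =>
    simp only [MidEdge.faces] at hd hx
    by_cases h2 : ((x, y) : Face) ∈ R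
    · have h1 : ((x - 1, y) : Face) ∉ R := fun h1 => hx ⟨fun _ => h2, fun _ => h1⟩
      obtain ⟨-, -, -, -, hW⟩ := hR _ h2
      obtain ⟨ex, ey⟩ := hW hd.1 h1
      exact ⟨y, ey, by rw [← ex]⟩
    · have h1 : ((x - 1, y) : Face) ∈ R := by
        by_contra h1; exact hx ⟨fun h => absurd h h1, fun h => absurd h h2⟩
      obtain ⟨-, hE, -, -, -⟩ := hR _ h1
      have e : ((x - 1 + 1, y) : Face) = (x, y) := Prod.ext (by show x - 1 + 1 = x; ring) rfl
      rw [e] at hE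
      exact absurd (hE hd.2) h2
  | slant x y =>
    simp only [MidEdge.faces] at hd hx
    exfalso
    by_cases h2 : ((x, y) : Face) ∈ R
    · have h1 : ((x, y - 1) : Face) ∉ R := fun h1 => hx ⟨fun _ => h2, fun _ => h1⟩
      obtain ⟨-, -, -, hS, -⟩ := hR _ h2
      exact h1 (hS hd.1)
    · have h1 : ((x, y - 1) : Face) ∈ R := by
        by_contra h1; exact hx ⟨fun h => absurd h h1, fun h => absurd h h2⟩
      obtain ⟨-, -, hN, -, -⟩ := hR _ h1
      have e : ((x, y - 1 + 1) : Face) = (x, y) := Prod.ext rfl (by show y - 1 + 1 = y; ring)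
      rw [e] at hN
      exact h2 (hN hd.2)

/-- The reflection on a cell, in coordinates. [cite: GlazmanManolescu2019, §4.2 (lattice symmetries)] -/
private theorem mirrorRowFace_mkC (w : Face) (x y : ℤ) : mirrorRowFace w.2 ((x, y) : Face) = (x, 2 * w.2 - y) := by
  simp [mirrorRowFace]

/-- The row mirror carries a northern corridor to a southern one. [cite: GlazmanManolescu2019, §4.2 (lattice symmetries)] -/
theorem isCorridorS_rowMirrorDom {D R : Set Face} (hR : IsCorridorN w D R) :
    IsCorridorS w (rowMirrorDom w D) (rowMirrorDom w R) := by
  intro c hc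
  obtain ⟨x, y⟩ := c
  simp only [mem_rowMirrorDom, mirrorRowFace_mkC] at hc ⊢
  obtain ⟨hq, hE, hN, hS, hW⟩ := hR _ hc
  simp only at hq hE hN hS hW
  refine ⟨hq, hE, ?_, ?_, ?_⟩
  · intro h; rw [show 2 * w.2 - (y + 1) = 2 * w.2 - y - 1 by ring] at h ⊢; exact hS h
  · intro h; rw [show 2 * w.2 - (y - 1) = 2 * w.2 - y + 1 by ring] at h ⊢; exact hN h
  · intro h h'; obtain ⟨ex, ey⟩ := hW h h'; exact ⟨ex, by omega⟩

/-- A cell with a side on a side of the far cell lies west of the root plaquette's column (coordinate form).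
[cite: GlazmanManolescu2019, §1 (the lattice of rhombi and its mid-edges)] -/
private theorem fst_lt_of_side_eq_farW_side {w c : Face} {s t : Side} (h : c.side s = (farW w).side t) :
    c.1 < w.1 := by
  obtain ⟨a, b⟩ := w
  obtain ⟨p, q⟩ := c
  cases s <;> cases t <;>
    simp only [farW, Face.side, MidEdge.vert.injEq, MidEdge.slant.injEq, reduceCtorEq] at h ⊢ <;> omega

end Corridors

namespace ΩG

variable {D : Set Face} {w : Face}

/-! ## §2 The parity count of the south-eastern quadrant, exported -/

/-- ★★ **THE SOUTH-EASTERN QUADRANT PARITY COUNT.** For a class-`B2a` walk at the far cell whose excursion polygon winds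
around the root, EITHER the excursion crosses the bottom side of the root plaquette OR the number of indices
`k ∈ (firstHitG + 1, n − 1]` at which the walk crosses a WEST edge of the south-eastern quadrant is ODD. (The count
inside the proof of `cross_root_S_or_exists_nth_isWestEdgeSE`, exported: quadrant-boundary crossings are even, the top
crossings are the eastern ray count, which is odd.) [cite: CourantRobbins1958, Ch. V Appendix §2 (The Jordan Curve Theorem for Polygons: the even–odd rule)]
[cite: Glazman2015WeightedSAW, Lemma 3.1 (proof, pp. 6–7: the classes of walks through a rhombus)] -/
theorem cross_root_S_or_odd_card_westEdgeSE [DecidablePred (IsWestEdgeSE w)]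
    (ω : ΩG D (w.side .W) (farW w)) (hr : RootedFace D (w.side .W) (farW w)) (h : ω.IsB2a)
    (hA : ω.AJ hr h (toC (midPt (w.side .W))) ≠ 0) :
    (∃ i, ω.2.firstHitG ≤ i ∧ i < ω.2.arcs.length ∧ ω.2.nth (i + 1) = w.side .S) ∨
      Odd ((Finset.Ioc (ω.2.firstHitG + 1) (ω.2.arcs.length - 1)).filter
        fun k => IsWestEdgeSE w (ω.2.nth k)).card := by
  classical
  have hodd := (ω.AJ_root_ne_zero_iff_odd_rayCountAt (hr := hr) h (b := holeFaceW w) (τ := .E)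
    (holeFaceW_side_E w)).1 hA
  have hF := ω.fh_lt h
  have hB2 : ω.2.firstHitG + 1 < ω.2.arcs.length := h.1
  set F := ω.2.firstHitG with hFdef
  set n := ω.2.arcs.length with hndef
  by_cases hcross : ∃ i, F ≤ i ∧ i < n ∧ ω.2.nth (i + 1) = w.side .S
  · exact Or.inl hcross
  right
  push Not at hcross
  let b : ℕ → Bool := fun k => decide (InQuadSE w (ω.2.fc k))
  have hbF : b (F + 1) = false := by
    have hin := (ω.2.side_sIn_nth (i := F + 1) hB2).1
    rw [(ω.2.exitSide_specG hr hF).1] at hin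
    have hne : ω.2.fc (F + 1) ≠ farW w := fc_ne ω hr h (by omega) hB2
    simp only [b, decide_eq_false_iff_not]
    exact not_inQuadSE_of_side_farW w hin hne
  have hbL : b (n - 1) = false := by
    have hout := (ω.2.side_sIn_nth (i := n - 1) (by omega)).2.1
    rw [show n - 1 + 1 = n by omega, ω.2.nth_length] at hout
    have hne : ω.2.fc (n - 1) ≠ farW w := fc_ne ω hr h (by omega) (by omega)
    simp only [b, decide_eq_false_iff_not]
    exact not_inQuadSE_of_side_farW w hout hne
  have heven := (even_card_changes_iff b (F + 1) (n - 1) (by omega)).2 (hbF.trans hbL.symm)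
  have hchg : ∀ k ∈ Finset.Ioc (F + 1) (n - 1),
      (b (k - 1) ≠ b k ↔ IsTopEdgeSE w (ω.2.nth k) ∨ IsWestEdgeSE w (ω.2.nth k)) := by
    intro k hk
    rw [Finset.mem_Ioc] at hk
    have hout := (ω.2.side_sIn_nth (i := k - 1) (by omega)).2.1
    have hin := (ω.2.side_sIn_nth (i := k) (by omega)).1
    rw [show k - 1 + 1 = k by omega] at hout
    have hne : ω.2.fc (k - 1) ≠ ω.2.fc (k - 1 + 1) := YBWalk.fc_succ_ne (by omega)
    rw [show k - 1 + 1 = k by omega] at hne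
    have key := quadrantSE_change_iff w ⟨_, hout⟩ ⟨_, hin⟩ hne
    simp only [b, ne_eq, decide_eq_decide]
    exact key
  set K := Finset.Ioc (F + 1) (n - 1) with hKdef
  set T := K.filter fun k => IsTopEdgeSE w (ω.2.nth k) with hTdef
  set E := K.filter fun k => IsWestEdgeSE w (ω.2.nth k) with hEdef
  have hsplit : (K.filter fun k => b (k - 1) ≠ b k) = T ∪ E := by
    ext k
    simp only [hTdef, hEdef, Finset.mem_union, Finset.mem_filter]
    constructor
    · rintro ⟨hk, hb⟩
      rcases (hchg k hk).1 hb with ht | he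
      · exact Or.inl ⟨hk, ht⟩
      · exact Or.inr ⟨hk, he⟩
    · rintro (⟨hk, ht⟩ | ⟨hk, he⟩)
      · exact ⟨hk, (hchg k hk).2 (Or.inl ht)⟩
      · exact ⟨hk, (hchg k hk).2 (Or.inr he)⟩
  have hdisj : Disjoint T E := by
    rw [Finset.disjoint_filter]
    intro k _ ht he
    exact not_isTopEdgeSE_and_isWestEdgeSE w _ ⟨ht, he⟩
  rw [hsplit, Finset.card_union_of_disjoint hdisj] at heven
  have hT : T.card = ω.rayCountAt hr h (holeFaceW w) .E := by
    unfold ΩG.rayCountAt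
    have hexit : ∀ j < ω.Mv, (ω.jFace h j).side (ω.jOut hr h j) = ω.2.nth (F + j + 1) :=
      fun j hj => side_jOut (hr := hr) h hj
    have hFM : F + ω.Mv = n := by unfold ΩG.Mv; omega
    symm
    refine Finset.card_bij' (fun j _ => F + j + 1) (fun k _ => k - F - 1) ?_ ?_ ?_ ?_
    · intro j hj
      rw [Finset.mem_filter, Finset.mem_range] at hj
      obtain ⟨hjM, m, hm⟩ := hj
      rw [hexit j hjM] at hm
      have hm1 : 1 ≤ m := by
        by_contra hlt
        have hm0 : m = 0 := by omega
        rw [hm0, ← root_side_S_eq_rayMid] at hm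
        exact hcross (F + j) (by omega) (by omega) hm
      have hlt : F + j + 1 ≤ n - 1 ∧ F + 2 ≤ F + j + 1 := by
        have h1 : F + j + 1 ≠ n := by
          intro e
          rw [e, ω.2.nth_length, rayMid_holeFaceW_E_eq] at hm
          exact farW_side_ne_slant_east w ω.1 m hm
        have h2 : j ≠ 0 := by
          rintro rfl
          rw [Nat.add_zero, (ω.2.exitSide_specG hr hF).1, rayMid_holeFaceW_E_eq] at hm
          exact farW_side_ne_slant_east w _ m hm
        omega
      rw [hTdef, Finset.mem_filter, hKdef, Finset.mem_Ioc]
      exact ⟨⟨by omega, hlt.1⟩, (isTopEdgeSE_iff w _).2 ⟨m, hm1, hm⟩⟩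
    · intro k hk
      rw [hTdef, Finset.mem_filter, hKdef, Finset.mem_Ioc] at hk
      obtain ⟨⟨hk1, hk2⟩, ht⟩ := hk
      obtain ⟨m, -, hm⟩ := (isTopEdgeSE_iff w _).1 ht
      rw [Finset.mem_filter, Finset.mem_range]
      refine ⟨by omega, m, ?_⟩
      rw [hexit _ (by omega), show F + (k - F - 1) + 1 = k by omega]
      exact hm
    · intro j hj; omega
    · intro k hk
      rw [hTdef, Finset.mem_filter, hKdef, Finset.mem_Ioc] at hk
      omega
  rw [hT] at heven
  have hEodd : Odd E.card := by
    rcases Nat.even_or_odd E.card with he | he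
    · exact absurd heven (Nat.not_even_iff_odd.2 (hodd.add_even he))
    · exact he
  convert hEodd using 2

/-! ## §3 The west crossing below the root plaquette, corridor form -/

/-- ★★★ **THE WEST CROSSING, CLOSED-CORRIDOR FORM.** `K_S1` absent; a closed corridor `R` below the kill row; every
western door of column `w.1 + 1` at a row `≤ w.2 − 3` absent or leading into `R`. Then a class-`B2a` walk at the far
cell whose excursion winds around the root crosses the bottom side of the root plaquette or the `E` side of the cell
below it: the excursion's crossings of `R`'s doors are even (it starts and ends outside `R`), its west-edge crossings
of the quadrant are odd, the kill row's door is shut — so the crossings at row `w.2 − 1` are odd.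
[cite: CourantRobbins1958, Ch. V Appendix §2 (the even–odd rule)] [cite: Glazman2015WeightedSAW, Lemma 3.1 (proof, pp. 6–7)] -/
theorem cross_root_S_or_exists_nth_eq_rootS_E_corridor (hK : killSE w ∉ D) {R : Set Face} (hR : IsCorridorS w D R)
    (hcol : ∀ y : ℤ, y ≤ w.2 - 3 → (w.1, y) ∉ D ∨ (w.1 + 1, y) ∉ D ∨ ((w.1 + 1, y) : Face) ∈ R)
    (ω : ΩG D (w.side .W) (farW w)) (hr : RootedFace D (w.side .W) (farW w)) (h : ω.IsB2a)
    (hA : ω.AJ hr h (toC (midPt (w.side .W))) ≠ 0) :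
    (∃ i, ω.2.firstHitG ≤ i ∧ i < ω.2.arcs.length ∧ ω.2.nth (i + 1) = w.side .S) ∨
      ∃ i, ω.2.firstHitG ≤ i ∧ i < ω.2.arcs.length ∧ ω.2.nth (i + 1) = (rootS w).side .E := by
  classical
  rcases ω.cross_root_S_or_odd_card_westEdgeSE hr h hA with hc | hodd
  · exact Or.inl hc
  right
  have hF := ω.fh_lt h
  have hB2 : ω.2.firstHitG + 1 < ω.2.arcs.length := h.1
  set F := ω.2.firstHitG with hFdef
  set n := ω.2.arcs.length with hndef
  set K := Finset.Ioc (F + 1) (n - 1) with hKdef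
  set E := K.filter fun k => IsWestEdgeSE w (ω.2.nth k) with hEdef
  -- membership in the corridor along the walk
  let bR : ℕ → Bool := fun k => decide (ω.2.fc k ∈ R)
  have hxR : ∀ {c : Face}, c.1 ≤ w.1 → c ∉ R := fun hc hcR => by have := (hR _ hcR).1; omega
  have hbF : bR (F + 1) = false := by
    have hin := (ω.2.side_sIn_nth (i := F + 1) hB2).1
    rw [(ω.2.exitSide_specG hr hF).1] at hin
    simp only [bR, decide_eq_false_iff_not]
    exact hxR (by have := fst_lt_of_side_eq_farW_side hin; omega)
  have hbL : bR (n - 1) = false := by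
    have hout := (ω.2.side_sIn_nth (i := n - 1) (by omega)).2.1
    rw [show n - 1 + 1 = n by omega, ω.2.nth_length] at hout
    simp only [bR, decide_eq_false_iff_not]
    exact hxR (by have := fst_lt_of_side_eq_farW_side hout; omega)
  have hevenR := (even_card_changes_iff bR (F + 1) (n - 1) (by omega)).2 (hbF.trans hbL.symm)
  -- the two faces of the `k`-th edge are the cells of arcs `k - 1`, `k`
  have hfaces : ∀ k ∈ K, ((ω.2.nth k).faces.1 ∈ D ∧ (ω.2.nth k).faces.2 ∈ D) ∧
      ((ω.2.fc (k - 1) = (ω.2.nth k).faces.1 ∧ ω.2.fc k = (ω.2.nth k).faces.2) ∨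
        (ω.2.fc (k - 1) = (ω.2.nth k).faces.2 ∧ ω.2.fc k = (ω.2.nth k).faces.1)) := by
    intro k hk
    rw [hKdef, Finset.mem_Ioc] at hk
    have hout := (ω.2.side_sIn_nth (i := k - 1) (by omega)).2.1
    have hin := (ω.2.side_sIn_nth (i := k) (by omega)).1
    rw [show k - 1 + 1 = k by omega] at hout
    have hne : ω.2.fc (k - 1) ≠ ω.2.fc (k - 1 + 1) := YBWalk.fc_succ_ne (by omega)
    rw [show k - 1 + 1 = k by omega] at hne
    refine ⟨ω.2.door_nth (j := k) (by omega) (by omega), ?_⟩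
    rcases (Face.exists_side_eq_iff _ _).1 ⟨_, hout⟩ with e1 | e1 <;>
      rcases (Face.exists_side_eq_iff _ _).1 ⟨_, hin⟩ with e2 | e2
    · exact absurd (e1.trans e2.symm) hne
    · exact Or.inl ⟨e1, e2⟩
    · exact Or.inr ⟨e1, e2⟩
    · exact absurd (e1.trans e2.symm) hne
  -- a corridor-door crossing is a west-edge crossing at a row `≤ w.2 - 3`
  have hflip : ∀ k ∈ K, bR (k - 1) ≠ bR k → ∃ y : ℤ, y ≤ w.2 - 3 ∧ ω.2.nth k = MidEdge.vert (w.1 + 1) y := by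
    intro k hk hb
    obtain ⟨hd, hf⟩ := hfaces k hk
    refine exists_eq_vert_of_corridor_door hR hd ?_
    simp only [bR, ne_eq, decide_eq_decide] at hb
    rcases hf with ⟨e1, e2⟩ | ⟨e1, e2⟩
    · rw [← e1, ← e2]; exact hb
    · rw [← e1, ← e2]; exact fun hh => hb hh.symm
  -- a west-edge crossing that is not a corridor-door crossing is at row `w.2 - 1`
  have hrest : ∀ k ∈ E, ¬(bR (k - 1) ≠ bR k) → ω.2.nth k = (rootS w).side .E := by
    intro k hk hb
    rw [hEdef, Finset.mem_filter] at hk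
    obtain ⟨hkK, hwest⟩ := hk
    obtain ⟨hd, hf⟩ := hfaces k hkK
    push Not at hb
    cases hnth : ω.2.nth k with
    | slant x y => rw [hnth] at hwest; exact absurd hwest (by simp [IsWestEdgeSE])
    | vert x y =>
      rw [hnth] at hwest hd hf
      simp only [IsWestEdgeSE] at hwest
      obtain ⟨hx, hy⟩ := hwest
      subst hx
      simp only [MidEdge.faces, add_sub_cancel_right] at hd hf
      have hy1 : y = w.2 - 1 := by
        rcases lt_or_eq_of_le hy with hlt | heq
        · exfalso
          rcases lt_or_eq_of_le (show y ≤ w.2 - 2 by omega) with hlt2 | heq2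
          · rcases hcol y (by omega) with hc | hc | hcR
            · exact hc hd.1
            · exact hc hd.2
            · -- the door leads into the corridor: the crossing IS a corridor-door crossing
              have hW : ((w.1, y) : Face) ∉ R := hxR le_rfl
              simp only [bR, decide_eq_decide] at hb
              rcases hf with ⟨e1, e2⟩ | ⟨e1, e2⟩
              · rw [e1, e2] at hb; exact hW (hb.2 hcR)
              · rw [e1, e2] at hb; exact hW (hb.1 hcR)
          · apply hK
            have e : killSE w = (w.1 + 1, y) := by rw [heq2]; rfl
            rw [e]; exact hd.2
        · exact heq
      rw [hy1]; obtain ⟨a, c⟩ := w; simp [rootS, Face.side]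
  -- counting: the corridor-door crossings in `K` are exactly the flips of `bR`, all in `E`; they are even
  have hsub : (K.filter fun k => bR (k - 1) ≠ bR k) = E.filter fun k => bR (k - 1) ≠ bR k := by
    ext k
    simp only [hEdef, Finset.mem_filter]
    constructor
    · rintro ⟨hk, hb⟩
      obtain ⟨y, hy, e⟩ := hflip k hk hb
      exact ⟨⟨hk, by rw [e]; exact ⟨rfl, by omega⟩⟩, hb⟩
    · rintro ⟨⟨hk, -⟩, hb⟩; exact ⟨hk, hb⟩
  rw [hsub] at hevenR
  have hcard := Finset.card_filter_add_card_filter_not (s := E) (fun k => bR (k - 1) ≠ bR k)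
  have hodd' : Odd (E.filter fun k => ¬(bR (k - 1) ≠ bR k)).card := by
    rcases Nat.even_or_odd (E.filter fun k => ¬(bR (k - 1) ≠ bR k)).card with he | he
    · exfalso
      rw [← hcard] at hodd
      exact Nat.not_even_iff_odd.2 hodd (hevenR.add he)
    · exact he
  obtain ⟨k, hk⟩ := Finset.card_pos.1 hodd'.pos
  rw [Finset.mem_filter] at hk
  have hkK : k ∈ K := (Finset.mem_filter.1 hk.1).1
  rw [hKdef, Finset.mem_Ioc] at hkK
  refine ⟨k - 1, by omega, by omega, ?_⟩
  rw [show k - 1 + 1 = k by omega]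
  exact hrest k hk.1 hk.2

/-! ## §4 The `K_S1` kill, corridor form -/

/-- ★★★ **THE DICHOTOMY FOR A WOUND UNDER-WALK, corridor form.** [cite: GlazmanManolescu2019, §1, Fig. 1 (two arcs at the two θ-corners weigh w₁)]
[cite: CourantRobbins1958, Ch. V Appendix §2 (the even–odd rule)] [cite: Glazman2015WeightedSAW, Lemma 3.1 (proof, pp. 6–7)] -/
theorem kindsIn_rootS_or_root_eq_of_AJ_ne_zero_under_corridor (hh : holeFaceW w ∉ D) (hK : killSE w ∉ D)
    {R : Set Face} (hR : IsCorridorS w D R)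
    (hcol : ∀ y : ℤ, y ≤ w.2 - 3 → (w.1, y) ∉ D ∨ (w.1 + 1, y) ∉ D ∨ ((w.1 + 1, y) : Face) ∈ R)
    (ω : ΩG D (w.side .W) (farW w)) (hr : RootedFace D (w.side .W) (farW w)) (h : ω.IsB2a)
    (hS : ω.2.firstSideG = .S) (hA : ω.AJ hr h (toC (midPt (w.side .W))) ≠ 0) :
    ω.2.kindsIn (rootS w) = [.corner, .corner] ∨ ω.2.kindsIn w = [.corner, .corner] := by
  have hF := ω.fh_lt h
  rcases ω.cross_root_S_or_exists_nth_eq_rootS_E_corridor hK hR hcol hr h hA with ⟨i, hFi, hin, e⟩ | ⟨i, hFi, hin, e⟩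
  · exact Or.inr (ω.kindsIn_root_eq_of_cross_root_S hh hr h ⟨i, hFi, hin, e⟩).2
  · left
    have hi1 : i + 1 < ω.2.arcs.length := by
      rcases Nat.lt_or_ge (i + 1) ω.2.arcs.length with hl | hl
      · exact hl
      · exfalso
        have e' : i + 1 = ω.2.arcs.length := by omega
        rw [e', ω.2.nth_length] at e
        exact farW_side_ne_rootS_side w ω.1 .E e
    have hFi' : ω.2.firstHitG < i := by
      rcases Nat.lt_or_ge ω.2.firstHitG i with hl | hl
      · exact hl
      · exfalso
        have eF : i = ω.2.firstHitG := by omega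
        have e1 : ω.2.nth (ω.2.firstHitG + 1) = (farW w).side (ω.z1 hr h) := (ω.2.exitSide_specG hr hF).1
        rw [eF, e1] at e
        exact farW_side_ne_rootS_side w _ .E e
    have hJ : ∃ j, j < ω.Mv ∧ (ω.jFace h j).side (ω.jOut hr h j) = (rootS w).side .E := by
      refine ⟨i - ω.2.firstHitG, by unfold ΩG.Mv; omega, ?_⟩
      rw [side_jOut (hr := hr) h (by unfold ΩG.Mv; omega),
        show ω.2.firstHitG + (i - ω.2.firstHitG) + 1 = i + 1 by omega, e]
    obtain ⟨i₀, hi₀1, hi₀F, hnth₀⟩ := exists_prefix_nth_eq_root_S_of_cross_rootS_E hh hr ω h hS hJ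
    exact kindsIn_rootS_eq_of_prefix_cross_of_cross_rootS_E ω hr h ⟨i₀, hi₀1, hi₀F, hnth₀⟩ ⟨i, hFi, hin, e⟩

/-- ★★★★ **THE STRUCTURAL `K_S1` KILL, corridor form**: hole, kill cell, a closed corridor taking every usable western
door of column `w.1 + 1` below the kill row ⇒ every WOUND class-`B2a` UNDER-walk at the far cell is NOT `w₁`-free off
the far cell. [cite: GlazmanManolescu2019, §1, Fig. 1 and the remark after eq. (1) («w₁ = 0 at θ = 2π/3»)]
[cite: CourantRobbins1958, Ch. V Appendix §2 (the even–odd rule)] [cite: Glazman2015WeightedSAW, Lemma 3.1 (proof, pp. 6–7)] -/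
theorem not_W1FreeOff_farW_of_wound_under_corridor (hh : holeFaceW w ∉ D) (hK : killSE w ∉ D)
    {R : Set Face} (hR : IsCorridorS w D R)
    (hcol : ∀ y : ℤ, y ≤ w.2 - 3 → (w.1, y) ∉ D ∨ (w.1 + 1, y) ∉ D ∨ ((w.1 + 1, y) : Face) ∈ R)
    (ω : ΩG D (w.side .W) (farW w)) (hr : RootedFace D (w.side .W) (farW w)) (h : ω.IsB2a)
    (hS : ω.2.firstSideG = .S) {θ : ℝ}
    (hW : ω.WE (fun _ => θ) ≠ excursionWinding θ ω.2.firstSideG (ω.z1 hr h) ω.1) : ¬ω.2.W1FreeOff (farW w) := by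
  have key : ω.2.kindsIn (rootS w) = [.corner, .corner] ∨ ω.2.kindsIn w = [.corner, .corner] := by
    rcases ω.AJ_ne_zero_or_rev_of_wound hr h θ hW with hA | hA
    · exact kindsIn_rootS_or_root_eq_of_AJ_ne_zero_under_corridor hh hK hR hcol ω hr h hS hA
    · have h' := ω.rev_isB2a hr h
      have hS' : (ω.rev hr).2.firstSideG = .S := by rw [ω.rev_firstSide hr h]; exact hS
      have perm : ∀ {g : Face}, g ≠ farW w → (ω.rev hr).2.kindsIn g = [.corner, .corner] →
          ω.2.kindsIn g = [.corner, .corner] := by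
        intro g hg hk
        have hperm := ω.kindsIn_rev_perm hr h hg
        rw [hk] at hperm
        have hp : (ω.2.kindsIn g).Perm (List.replicate 2 .corner) := hperm.symm
        exact List.perm_replicate.1 hp
      rcases kindsIn_rootS_or_root_eq_of_AJ_ne_zero_under_corridor hh hK hR hcol (ω.rev hr) hr h' hS' hA with hk | hk
      · exact Or.inl (perm (rootS_ne_farW w) hk)
      · exact Or.inr (perm (root_ne_farW w) hk)
  intro hfree
  rcases key with hk | hk
  · have hmem : rootS w ∈ ω.2.facesVisited := by
      by_contra hn
      rw [YBWalk.kindsIn_eq_nil hn] at hk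
      exact List.cons_ne_nil _ _ hk.symm
    exact hfree _ hmem (rootS_ne_farW w) hk
  · have hmem : w ∈ ω.2.facesVisited := by
      by_contra hn
      rw [YBWalk.kindsIn_eq_nil hn] at hk
      exact List.cons_ne_nil _ _ hk.symm
    exact hfree _ hmem (root_ne_farW w) hk

/-- ★★★★ «Every wound under-walk is `w₁`-marked off the far cell», corridor form.
[cite: GlazmanManolescu2019, §1, remark after eq. (1)] [cite: CourantRobbins1958, Ch. V Appendix §2 (the even–odd rule)] -/
theorem under_w1_killed_of_killSE_corridor (hh : holeFaceW w ∉ D) (hK : killSE w ∉ D)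
    {R : Set Face} (hR : IsCorridorS w D R)
    (hcol : ∀ y : ℤ, y ≤ w.2 - 3 → (w.1, y) ∉ D ∨ (w.1 + 1, y) ∉ D ∨ ((w.1 + 1, y) : Face) ∈ R)
    (hr : RootedFace D (w.side .W) (farW w)) (θ : ℝ) :
    ∀ (ω : ΩG D (w.side .W) (farW w)) (h : ω.IsB2a), ω.2.firstSideG = .S →
      ω.WE (fun _ => θ) ≠ excursionWinding θ ω.2.firstSideG (ω.z1 hr h) ω.1 → ¬ω.2.W1FreeOff (farW w) :=
  fun ω h hS hW => not_W1FreeOff_farW_of_wound_under_corridor hh hK hR hcol ω hr h hS hW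

/-! ## §5 The `K_N2` kill, corridor form (row mirror) -/

/-- ★★★★ **THE STRUCTURAL `K_N2` KILL, corridor form** (row-mirror twin). [cite: GlazmanManolescu2019, §1, Fig. 1 and the paragraph of Fig. 2 («if θ = π/3, then w₂ = 0»)]
[cite: CourantRobbins1958, Ch. V Appendix §2 (the even–odd rule)] [cite: Glazman2015WeightedSAW, Lemma 3.1 (proof, pp. 6–7)] -/
theorem not_W2FreeOff_farW_of_wound_over_corridor (hh : holeFaceW w ∉ D) (hK : killNE w ∉ D)
    {R : Set Face} (hR : IsCorridorN w D R)
    (hcol : ∀ y : ℤ, w.2 + 3 ≤ y → (w.1, y) ∉ D ∨ (w.1 + 1, y) ∉ D ∨ ((w.1 + 1, y) : Face) ∈ R)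
    (ω : ΩG D (w.side .W) (farW w)) (hr : RootedFace D (w.side .W) (farW w)) (h : ω.IsB2a)
    (hN : ω.2.firstSideG = .N) {θ : ℝ}
    (hW : ω.WE (fun _ => θ) ≠ excursionWinding θ ω.2.firstSideG (ω.z1 hr h) ω.1) : ¬ω.2.W2FreeOff (farW w) := by
  have hr' := rootedFace_rowMirrorDom w hr
  have h' := ω.mirrorFar_isB2a hr h
  have hh' : holeFaceW w ∉ rowMirrorDom w D := by rwa [mem_rowMirrorDom, mirrorRowFace_holeFaceW]
  have hK' : killSE w ∉ rowMirrorDom w D := by rwa [mem_rowMirrorDom, mirrorRowFace_killSE]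
  have hR' := isCorridorS_rowMirrorDom hR
  have hcol' : ∀ y : ℤ, y ≤ w.2 - 3 → (w.1, y) ∉ rowMirrorDom w D ∨ (w.1 + 1, y) ∉ rowMirrorDom w D ∨
      ((w.1 + 1, y) : Face) ∈ rowMirrorDom w R := by
    intro y hy
    simp only [mem_rowMirrorDom, mirrorRowFace_mkC]
    exact hcol (2 * w.2 - y) (by omega)
  have hS' : ω.mirrorFar.2.firstSideG = .S := by rw [ω.mirrorFar_firstSideG, hN]; rfl
  have hkill := not_W1FreeOff_farW_of_wound_under_corridor hh' hK' hR' hcol' ω.mirrorFar hr' h' hS'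
    (ω.mirrorFar_wound hr h hW)
  intro hfree
  apply hkill
  intro g hg hgf hk
  have hk2 := ω.kindsIn_eq_coCorner_of_mirrorFar_corner hk
  have hmem : mirrorRowFace w.2 g ∈ ω.2.facesVisited := by
    by_contra hn
    rw [YBWalk.kindsIn_eq_nil hn] at hk2
    exact List.cons_ne_nil _ _ hk2.symm
  have hne : mirrorRowFace w.2 g ≠ farW w := by
    intro e
    apply hgf
    have e' := congrArg (mirrorRowFace w.2) e
    rw [mirrorRowFace_mirrorRowFace, mirrorRowFace_farW] at e'
    exact e'
  exact hfree _ hmem hne hk2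

/-- ★★★★ «Every wound over-walk is `w₂`-marked off the far cell», corridor form.
[cite: GlazmanManolescu2019, §1 (the paragraph of Fig. 2)] [cite: CourantRobbins1958, Ch. V Appendix §2 (the even–odd rule)] -/
theorem over_w2_killed_of_killNE_corridor (hh : holeFaceW w ∉ D) (hK : killNE w ∉ D)
    {R : Set Face} (hR : IsCorridorN w D R)
    (hcol : ∀ y : ℤ, w.2 + 3 ≤ y → (w.1, y) ∉ D ∨ (w.1 + 1, y) ∉ D ∨ ((w.1 + 1, y) : Face) ∈ R)
    (hr : RootedFace D (w.side .W) (farW w)) (θ : ℝ) :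
    ∀ (ω : ΩG D (w.side .W) (farW w)) (h : ω.IsB2a), ω.2.firstSideG = .N →
      ω.WE (fun _ => θ) ≠ excursionWinding θ ω.2.firstSideG (ω.z1 hr h) ω.1 → ¬ω.2.W2FreeOff (farW w) :=
  fun ω h hN hW => not_W2FreeOff_farW_of_wound_over_corridor hh hK hR hcol ω hr h hN hW

end ΩG

end Literature.Probability.RandomPlanarGeometry.SAW.YangBaxter

namespace Literature.Barriers.CriticalPhenomena.PlaquetteWalk

open Literature.Probability.RandomPlanarGeometry.SAW.YangBaxter
open Real Complex

/-! ## §6 The eastern sign schemas, corridor form — reference position -/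

section At42

variable {Dl : List Face}

/-- ★★★★ **`K_N2` ALONE ⇒ `Im VF(π/3) < 0`**, reference position, corridor form: east block, hole and `K_N2 = (5,4)`
absent, a closed corridor `R` above the kill row taking every usable western door of column `5` above row `4`.
[cite: GlazmanManolescu2019, Lemma 2.1 (statement, "in the form given in [Gl]")] [cite: GlazmanManolescu2019, §1 (the paragraph of Fig. 2)] -/
theorem im_neg_pi_div_three_of_killNE_block42_corridor (hB : ∀ c ∈ eastBlock42, c ∈ Dl)
    (hh : holeFaceW w42 ∉ dom Dl) (hKN : killNE w42 ∉ dom Dl) {R : Set Face} (hR : IsCorridorN w42 (dom Dl) R)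
    (hcolN : ∀ y : ℤ, w42.2 + 3 ≤ y → (w42.1, y) ∉ dom Dl ∨ (w42.1 + 1, y) ∉ dom Dl ∨ ((w42.1 + 1, y) : Face) ∈ R) :
    (vertexFunctional (printedWeights (π / 3)) tFiveEighths (ybCoeff (π / 3)) Dl (w42.side .W) (farW w42)).im < 0 := by
  have hf : farW w42 ∈ Dl := hB _ (by decide)
  have hr := rootedFace_of_farW_mem_of_hole hf hh
  exact im_vertexFunctional_printed_farCellW_pi_div_three_neg_of_over_killed Dl w42 hf hh hr
    (ΩG.over_w2_killed_of_killNE_corridor hh hKN hR hcolN hr _) (exists_under_witness_of_eastBlock42 hB hr _)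

/-- ★★★★ **`K_S1` ALONE ⇒ `Im VF(2π/3) > 0`**, reference position, corridor form.
[cite: GlazmanManolescu2019, Lemma 2.1 (statement, "in the form given in [Gl]")] [cite: GlazmanManolescu2019, §1, remark after eq. (1)] -/
theorem im_pos_two_pi_div_three_of_killSE_block42_corridor (hB : ∀ c ∈ eastBlock42, c ∈ Dl)
    (hh : holeFaceW w42 ∉ dom Dl) (hKS : killSE w42 ∉ dom Dl) {R : Set Face} (hR : IsCorridorS w42 (dom Dl) R)
    (hcolS : ∀ y : ℤ, y ≤ w42.2 - 3 → (w42.1, y) ∉ dom Dl ∨ (w42.1 + 1, y) ∉ dom Dl ∨ ((w42.1 + 1, y) : Face) ∈ R) :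
    0 < (vertexFunctional (printedWeights (2 * π / 3)) tFiveEighths (ybCoeff (2 * π / 3)) Dl (w42.side .W)
      (farW w42)).im := by
  have hf : farW w42 ∈ Dl := hB _ (by decide)
  have hr := rootedFace_of_farW_mem_of_hole hf hh
  exact im_vertexFunctional_printed_farCellW_two_pi_div_three_pos_of_under_killed Dl w42 hf hh hr
    (ΩG.under_w1_killed_of_killSE_corridor hh hKS hR hcolS hr _) (exists_over_witness_of_eastBlock42 hB hr _)

end At42

/-! ## §7 Every position -/

section Translate

variable {Dl : List Face} {w : Face}

/-- Transport of a southern corridor to the reference position (the corridor travels with the domain).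
[cite: GlazmanManolescu2019, §4.2 (translation invariance)] -/
theorem isCorridorS_refShift {R : Set Face} (hR : IsCorridorS w (dom Dl) R) :
    IsCorridorS w42 (dom (Dl.map (Face.shiftBy (-refShift w)))) {c | Face.shiftBy (refShift w) c ∈ R} := by
  intro c hc
  obtain ⟨x, y⟩ := c
  simp only [Set.mem_setOf_eq, shiftBy_refShift_mk] at hc
  obtain ⟨hq, hE, hN, hS, hW⟩ := hR _ hc
  simp only at hq hE hN hS hW
  simp only [Set.mem_setOf_eq, mem_dom_map_shiftBy_neg, shiftBy_refShift_mk, w42]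
  have e1 : ((x + 1 + (w.1 - 4), y + (w.2 - 2)) : Face) = (x + (w.1 - 4) + 1, y + (w.2 - 2)) :=
    Prod.ext (by show x + 1 + (w.1 - 4) = x + (w.1 - 4) + 1; ring) rfl
  have e2 : ((x + (w.1 - 4), y + 1 + (w.2 - 2)) : Face) = (x + (w.1 - 4), y + (w.2 - 2) + 1) :=
    Prod.ext rfl (by show y + 1 + (w.2 - 2) = y + (w.2 - 2) + 1; ring)
  have e3 : ((x + (w.1 - 4), y - 1 + (w.2 - 2)) : Face) = (x + (w.1 - 4), y + (w.2 - 2) - 1) :=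
    Prod.ext rfl (by show y - 1 + (w.2 - 2) = y + (w.2 - 2) - 1; ring)
  have e4 : ((x - 1 + (w.1 - 4), y + (w.2 - 2)) : Face) = (x + (w.1 - 4) - 1, y + (w.2 - 2)) :=
    Prod.ext (by show x - 1 + (w.1 - 4) = x + (w.1 - 4) - 1; ring) rfl
  refine ⟨by omega, fun h => ?_, fun h => ?_, fun h => ?_, fun h h' => ?_⟩
  · rw [e1] at h ⊢; exact hE h
  · rw [e2] at h ⊢; exact hN h
  · rw [e3] at h ⊢; exact hS h
  · rw [e4] at h h'
    obtain ⟨ex, ey⟩ := hW h h'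
    constructor <;> omega

/-- Transport of a northern corridor to the reference position. [cite: GlazmanManolescu2019, §4.2 (translation invariance)] -/
theorem isCorridorN_refShift {R : Set Face} (hR : IsCorridorN w (dom Dl) R) :
    IsCorridorN w42 (dom (Dl.map (Face.shiftBy (-refShift w)))) {c | Face.shiftBy (refShift w) c ∈ R} := by
  intro c hc
  obtain ⟨x, y⟩ := c
  simp only [Set.mem_setOf_eq, shiftBy_refShift_mk] at hc
  obtain ⟨hq, hE, hN, hS, hW⟩ := hR _ hc
  simp only at hq hE hN hS hW
  simp only [Set.mem_setOf_eq, mem_dom_map_shiftBy_neg, shiftBy_refShift_mk, w42]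
  have e1 : ((x + 1 + (w.1 - 4), y + (w.2 - 2)) : Face) = (x + (w.1 - 4) + 1, y + (w.2 - 2)) :=
    Prod.ext (by show x + 1 + (w.1 - 4) = x + (w.1 - 4) + 1; ring) rfl
  have e2 : ((x + (w.1 - 4), y + 1 + (w.2 - 2)) : Face) = (x + (w.1 - 4), y + (w.2 - 2) + 1) :=
    Prod.ext rfl (by show y + 1 + (w.2 - 2) = y + (w.2 - 2) + 1; ring)
  have e3 : ((x + (w.1 - 4), y - 1 + (w.2 - 2)) : Face) = (x + (w.1 - 4), y + (w.2 - 2) - 1) :=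
    Prod.ext rfl (by show y - 1 + (w.2 - 2) = y + (w.2 - 2) - 1; ring)
  have e4 : ((x - 1 + (w.1 - 4), y + (w.2 - 2)) : Face) = (x + (w.1 - 4) - 1, y + (w.2 - 2)) :=
    Prod.ext (by show x - 1 + (w.1 - 4) = x + (w.1 - 4) - 1; ring) rfl
  refine ⟨by omega, fun h => ?_, fun h => ?_, fun h => ?_, fun h h' => ?_⟩
  · rw [e1] at h ⊢; exact hE h
  · rw [e2] at h ⊢; exact hN h
  · rw [e3] at h ⊢; exact hS h
  · rw [e4] at h h'
    obtain ⟨ex, ey⟩ := hW h h'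
    constructor <;> omega

/-- ★★★★★ **`K_N2` ALONE ⇒ `Im VF(π/3) < 0`, EVERY POSITION, corridor form** — the master form of the eastern over-route
kill: hole and `K_N2` absent, a closed corridor `R` above the kill row, every usable western door of column `w.1 + 1`
above the kill row leading into `R`. [cite: GlazmanManolescu2019, Lemma 2.1, §4.2]
[cite: GlazmanManolescu2019, §1 (the paragraph of Fig. 2)] [cite: CourantRobbins1958, Ch. V Appendix §2 (the even–odd rule)] -/
theorem im_vertexFunctional_printed_pi_div_three_neg_of_killNE_corridor (hB : ∀ c ∈ eastBlock w, c ∈ Dl)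
    (hh : holeFaceW w ∉ dom Dl) (hKN : killNE w ∉ dom Dl) {R : Set Face} (hR : IsCorridorN w (dom Dl) R)
    (hcolN : ∀ y : ℤ, w.2 + 3 ≤ y → (w.1, y) ∉ dom Dl ∨ (w.1 + 1, y) ∉ dom Dl ∨ ((w.1 + 1, y) : Face) ∈ R) :
    (vertexFunctional (printedWeights (π / 3)) tFiveEighths (ybCoeff (π / 3)) Dl (w.side .W) (farW w)).im < 0 := by
  rw [vertexFunctional_printed_eq_refShift Dl w]
  refine im_neg_pi_div_three_of_killNE_block42_corridor (eastBlock42_mem_of_eastBlock hB) ?_ ?_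
    (isCorridorN_refShift hR) ?_
  · rw [mem_dom_map_shiftBy_neg, shiftBy_refShift_holeFaceW]; exact hh
  · refine not_mem_refShift 5 4 ?_
    have e : ((5 + (w.1 - 4), 4 + (w.2 - 2)) : Face) = killNE w := Prod.ext (by simp [killNE]; ring) (by simp [killNE]; ring)
    rw [e]; exact hKN
  · intro y hy
    simp only [w42] at hy ⊢
    rw [show ((4 : ℤ) + 1, y) = ((5 : ℤ), y) by norm_num]
    rcases hcolN (y + (w.2 - 2)) (by omega) with h | h | h
    · left; refine not_mem_refShift 4 y ?_
      have e : ((4 + (w.1 - 4), y + (w.2 - 2)) : Face) = (w.1, y + (w.2 - 2)) := Prod.ext (by show 4 + (w.1 - 4) = w.1; ring) rfl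
      rw [e]; exact h
    · right; left; refine not_mem_refShift 5 y ?_
      have e : ((5 + (w.1 - 4), y + (w.2 - 2)) : Face) = (w.1 + 1, y + (w.2 - 2)) := Prod.ext (by show 5 + (w.1 - 4) = w.1 + 1; ring) rfl
      rw [e]; exact h
    · right; right
      simp only [Set.mem_setOf_eq, shiftBy_refShift_mk]
      have e : ((5 + (w.1 - 4), y + (w.2 - 2)) : Face) = (w.1 + 1, y + (w.2 - 2)) := Prod.ext (by show 5 + (w.1 - 4) = w.1 + 1; ring) rfl
      rw [e]; exact h

/-- ★★★★★ **`K_S1` ALONE ⇒ `Im VF(2π/3) > 0`, EVERY POSITION, corridor form.** [cite: GlazmanManolescu2019, Lemma 2.1, §4.2]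
[cite: GlazmanManolescu2019, §1, remark after eq. (1)] [cite: CourantRobbins1958, Ch. V Appendix §2 (the even–odd rule)] -/
theorem im_vertexFunctional_printed_two_pi_div_three_pos_of_killSE_corridor (hB : ∀ c ∈ eastBlock w, c ∈ Dl)
    (hh : holeFaceW w ∉ dom Dl) (hKS : killSE w ∉ dom Dl) {R : Set Face} (hR : IsCorridorS w (dom Dl) R)
    (hcolS : ∀ y : ℤ, y ≤ w.2 - 3 → (w.1, y) ∉ dom Dl ∨ (w.1 + 1, y) ∉ dom Dl ∨ ((w.1 + 1, y) : Face) ∈ R) :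
    0 < (vertexFunctional (printedWeights (2 * π / 3)) tFiveEighths (ybCoeff (2 * π / 3)) Dl (w.side .W) (farW w)).im := by
  rw [vertexFunctional_printed_eq_refShift Dl w]
  refine im_pos_two_pi_div_three_of_killSE_block42_corridor (eastBlock42_mem_of_eastBlock hB) ?_ ?_
    (isCorridorS_refShift hR) ?_
  · rw [mem_dom_map_shiftBy_neg, shiftBy_refShift_holeFaceW]; exact hh
  · refine not_mem_refShift 5 0 ?_
    have e : ((5 + (w.1 - 4), 0 + (w.2 - 2)) : Face) = killSE w := Prod.ext (by simp [killSE]; ring) (by simp [killSE])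
    rw [e]; exact hKS
  · intro y hy
    simp only [w42] at hy ⊢
    rw [show ((4 : ℤ) + 1, y) = ((5 : ℤ), y) by norm_num]
    rcases hcolS (y + (w.2 - 2)) (by omega) with h | h | h
    · left; refine not_mem_refShift 4 y ?_
      have e : ((4 + (w.1 - 4), y + (w.2 - 2)) : Face) = (w.1, y + (w.2 - 2)) := Prod.ext (by show 4 + (w.1 - 4) = w.1; ring) rfl
      rw [e]; exact h
    · right; left; refine not_mem_refShift 5 y ?_
      have e : ((5 + (w.1 - 4), y + (w.2 - 2)) : Face) = (w.1 + 1, y + (w.2 - 2)) := Prod.ext (by show 5 + (w.1 - 4) = w.1 + 1; ring) rfl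
      rw [e]; exact h
    · right; right
      simp only [Set.mem_setOf_eq, shiftBy_refShift_mk]
      have e : ((5 + (w.1 - 4), y + (w.2 - 2)) : Face) = (w.1 + 1, y + (w.2 - 2)) := Prod.ext (by show 5 + (w.1 - 4) = w.1 + 1; ring) rfl
      rw [e]; exact h

end Translate

/-! ## §8 The corridor row `57b (4,4)` of the corner-kill table, as a closed sign theorem -/

section Instances

/-- LAW L frame `57b` = `5×7 ∖ (2, 2)` with the kill cell `(4, 4)` removed alone: beyond it the east wall column
continues as the two-cell corridor `(4,5), (4,6)`. [cite: GlazmanManolescu2019, §2.1 (finite domains of faces)] -/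
def frame57b_KN2 : List Face := [(0,0),(0,1),(0,2),(0,3),(0,4),(0,5),(0,6),(1,0),(1,1),(1,2),(1,3),(1,4),(1,5),(1,6),(2,0),(2,1),(2,3),(2,4),(2,5),(2,6),(3,0),(3,1),(3,2),(3,3),(3,4),(3,5),(3,6),(4,0),(4,1),(4,2),(4,3),(4,5),(4,6)]

/-- The corridor of frame `57b` above the kill cell `(4, 4)`. [cite: GlazmanManolescu2019, §2.1 (finite domains of faces)] -/
def corridor57b_N : List Face := [(4,5),(4,6)]

/-- The corridor condition of frame `57b`, checked cell by cell (each clause decided on the lists).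
[cite: CourantRobbins1958, Ch. V Appendix §2 (the even–odd rule)] -/
theorem isCorridorN_frame57b : IsCorridorN (3, 2) (dom frame57b_KN2) (dom corridor57b_N) := by
  intro c hc
  have hc' : c = (4, 5) ∨ c = (4, 6) := by simpa [dom, corridor57b_N] using hc
  simp only [dom, Set.mem_setOf_eq]
  rcases hc' with rfl | rfl
  · exact ⟨by decide, by decide, by decide, by decide, by decide⟩
  · exact ⟨by decide, by decide, by decide, by decide, by decide⟩

/-- ★★ LAW L, frame `57b` (`5×7 ∖ (2, 2)`), cell `(4, 4)` = `K_N2` (over route, `w₂`): the corner-kill table's first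
CORRIDOR row as a closed sign theorem — no local column clause applies (`(3,5)`, `(4,5)`, `(3,6)`, `(4,6)` all present,
no dead end); the corridor clause does. [cite: GlazmanManolescu2019, Lemma 2.1 (statement, "in the form given in [Gl]")] -/
theorem frame57b_KN2_sign : (vertexFunctional (printedWeights (π / 3)) tFiveEighths (ybCoeff (π / 3)) frame57b_KN2 (Face.side (3, 2) .W) (farW (3, 2))).im < 0 :=
  im_vertexFunctional_printed_pi_div_three_neg_of_killNE_corridor (Dl := frame57b_KN2) (w := (3, 2)) (by decide)
    (show holeFaceW (3, 2) ∉ frame57b_KN2 by decide) (show killNE (3, 2) ∉ frame57b_KN2 by decide)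
    (R := dom corridor57b_N) isCorridorN_frame57b
    (fun y hy => by
      rcases (show y = 5 ∨ y = 6 ∨ 7 ≤ y by simp only at hy; omega) with rfl | rfl | hy'
      · exact Or.inr (Or.inr (show ((3 : ℤ) + 1, (5 : ℤ)) ∈ corridor57b_N by decide))
      · exact Or.inr (Or.inr (show ((3 : ℤ) + 1, (6 : ℤ)) ∈ corridor57b_N by decide))
      · exact Or.inl (show ((3 : ℤ), y) ∉ frame57b_KN2 by
          simp only [frame57b_KN2, List.mem_cons, Prod.mk.injEq, List.not_mem_nil, or_false, not_or, not_and]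
          omega))

end Instances

end Literature.Barriers.CriticalPhenomena.PlaquetteWalk
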